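import Summits.NavierStokesRegularity.NavierStokesRegularity.Theses.LerayQuarterDissipation
import Summits.NavierStokesRegularity.NavierStokesRegularity.Theorems.LerayQuarterDissipationFiniteDissipationLiouvilleThresholdLimit
import Summits.NavierStokesRegularity.NavierStokesRegularity.Theorems.LerayQuarterDissipationFiniteDissipationLiouvilleThresholdVortexLines
import Summits.NavierStokesRegularity.NavierStokesRegularity.Theorems.LerayQuarterDissipationFiniteDissipationLiouvilleEnvelopePackage
import Summits.NavierStokesRegularity.NavierStokesRegularity.Theorems.LerayQuarterDissipationFiniteDissipationLiouvilleCalmSliceForward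
import Literature.Analysis.FluidPDE.BarkerPrange2020VorticityAlignmentTypeIHolds
import Literature.Analysis.FluidPDE.CurlFreeLiouville
import HarnessLib

/-!
# Crux `FiniteDissipationLiouville` (stmt-NavierStokesRegularity-22144): THE LAW-FREE THRESHOLD IS NOT
# ATTAINED — no finite-dissipation Type-I singularity has Type-I constant `C ≤ 1`, and the crux
# HOLDS for `C ≤ 1 + ε(K)`

Theorems file of route `LerayQuarterDissipation` (lead prover g14; `--supports` the crux; file 5 of the
THRESHOLD-ONE chain `…ThresholdBudget`, `…ThresholdVortexLines`, `…ThresholdSecondDerivatives`,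
`…ThresholdLimit`). Navier–Stokes regularity is NOT proved by anything here; no summit is. This file
PROVES THE CRUX IN A NEW REGION OF ITS PARAMETER PLANE: the tree's law-free Liouville theorem T31⁗
(`SimilarityEnstrophy.typeI_ancient_eq_zero_of_rate_lt_one`, route DssFarFieldSlaving) kills every
Type-I ancient mild field with `‖V(t,x)‖ ≤ C/√(−t)`, `C < 1`; with the quarter-rate dissipation law
the borderline `C = 1` falls as well, and by compactness the threshold moves to `1 + ε(K)`.

* `not_singular_of_typeI_one` — **NO SINGULAR MEMBER OF `𝒟_{1,K}`.** If there were one, there would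
  be a critical element `W ∈ 𝒟_{1,K_c}` (`CriticalElement.exists_minimal_singular`); by
  `…ThresholdLimit.exists_singular_limit_slack_eq_zero` some KNSS limit `V ∈ 𝒟_{1,K_c}` of its
  rescalings is SINGULAR with `(1 − ‖U‖)‖DΩ Ω‖ ≡ 0` on the slice `U = V(−1,·)`, `Ω = curl U` — the
  equality case of the stretching step `|⟪U, DΩ Ω⟫| ≤ ‖DΩ Ω‖` of the similarity enstrophy budget
  (`…ThresholdBudget`: at `C = 1` the budget reads `Z_R' ≤ η/R − slack`, so the slack cannot stay
  away from `0`). `V` is again critical, hence carries the envelope `‖V‖ ≤ A/(‖x‖+√(−t))`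
  (`Envelope.envelope_of_minimal`) and the scale-invariant package
  (`Envelope.scaleInvariantBounds_of_minimal`: `‖Ω(y)‖ ≲ (1+‖y‖)⁻²`). DICHOTOMY: either `DΩ Ω ≠ 0`
  somewhere — then `‖U‖ = 1` on a non-empty open set, hence everywhere (the slice is real-analytic,
  `IsTypeIAncientMild.analyticOnNhd_slice_univ`; identity theorem for `‖U‖² − 1`), contradicting the
  envelope at infinity; or `DΩ Ω ≡ 0` — then `Ω ≡ 0` (`…ThresholdVortexLines`: a decaying field
  constant along itself vanishes), `U` is curl- and divergence-free and bounded, hence constant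
  (`eq_of_curl_eq_zero_of_isDivFree_of_bounded`), hence `0` by the envelope, and a member with a zero
  slice is not singular (`CalmSlice.not_singular_of_zero_slice`).
* `not_singular_of_typeI_le_one` — the same for every `C ≤ 1` (monotonicity of the class in `C`).
* `exists_typeI_gap` — **THE TYPE-I CONSTANT OF A FINITE-DISSIPATION TYPE-I SINGULARITY EXCEEDS `1`
  BY A DEFINITE AMOUNT**: `∀ K ∃ ε > 0`, no singular member of `𝒟_{C,K}` has `C ≤ 1 + ε` (KNSS
  compactness across members with constants `C_n ↓ 1`, persistence of the singularity, the law of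
  the limit, and the pointwise improvement of the limit's Type-I constant to `1`).
* `finiteDissipationLiouville_below_gap` — **THE CRUX HOLDS FOR `C ≤ 1 + ε(K)`** (its signature
  verbatim, restricted).

HONEST FRAMING: `ε(K)` comes from compactness (ineffective); nothing is claimed for larger `C`; the
crux itself (all `C`) stays blocked on `∀ c > 1, TypeIDSSLiouville c` (NECESSARY, `…Hardness`). For the
portrait: a counterexample (DSS or wandering) has `C ≥ 1 + ε(K)`, improving lead g2's `C ≥ 1`.
presearch (corpus hybrid+vec, galaxy all, 2026-08-28): Liouville theorems for Type-I ancient /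
backward self-similar Navier–Stokes at the borderline constant → none beyond the small-constant
results (KNSS 2009 Thm 6.x small data; Tsai 1998; the tree's T31 family); the equality-case argument
for the stretching inequality is not in print for this class.

References: Koch–Nadirashvili–Seregin–Šverák, Acta Math. 203 (2009) = arXiv:0709.3599 §4, Lemma 6.1;
Tsai, ARMA 143 (1998); Chae–Wolf, arXiv:1610.09464 (envelope); the tree's T31⁗ files.
-/

noncomputable section

set_option linter.dupNamespace false

namespace Summit.NavierStokesRegularity.NavierStokesRegularity.Theorems.FiniteDissipationLiouville.ThresholdOne

open MeasureTheory Set Filter Topology Metric InnerProductSpace Function Real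
open scoped RealInnerProductSpace ContDiff
open Literature.Analysis Literature.Analysis.FluidPDE
open Summit.NavierStokesRegularity.NavierStokesRegularity.Theorems
open Summit.NavierStokesRegularity.NavierStokesRegularity.Theorems.FiniteDissipationLiouville

/-! ### No singular member at the threshold `C = 1` -/

/-- **NO FINITE-DISSIPATION TYPE-I SINGULARITY HAS TYPE-I CONSTANT `1`.** A Type-I ancient mild field
in the KNSS gauge with `‖u(t,x)‖ ≤ 1/√(−t)` and the quarter-rate dissipation law
`∫‖∇u(s)‖² ≤ K/√(−s)` is bounded on some backward parabolic cylinder at the origin. (Critical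
element; equality case of the similarity enstrophy budget on a singular KNSS limit; dichotomy
`‖U‖ ≡ 1` (analyticity, envelope) / `DΩ Ω ≡ 0` (vortex lines, curl-free Liouville, envelope, forward
uniqueness).) [cite: KochNadirashviliSereginSverak2009, §4 (arXiv:0709.3599 p. 8)] -/
theorem not_singular_of_typeI_one {K : ℝ}
    {u : ℝ → EuclideanSpace ℝ (Fin 3) → EuclideanSpace ℝ (Fin 3)} (hu : IsTypeIAncientMild 1 u)
    (hlaw : ∀ s : ℝ, s < 0 → ∫⁻ x, ‖fderiv ℝ (u s) x‖ₑ ^ 2 ≤ ENNReal.ofReal (K / Real.sqrt (-s))) :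
    ¬ (∀ r > 0, ∀ M : ℝ, ∃ t ∈ Ioo (-(r ^ 2)) (0 : ℝ),
      ∃ x ∈ ball (0 : EuclideanSpace ℝ (Fin 3)) r, M < ‖u t x‖) := by
  intro hsing
  -- ### the critical element and the singular limit in the equality case
  obtain ⟨Kc, -, ⟨W, hW, hWlaw, hWsing⟩, hmin⟩ := CriticalElement.exists_minimal_singular hu hlaw hsing
  obtain ⟨V, hV, hVlaw, hVsing, hslack⟩ := exists_singular_limit_slack_eq_zero hW hWlaw hWsing
  -- ### envelope and package of the (critical) limit
  obtain ⟨A, hA0, henv⟩ := Envelope.envelope_of_minimal hmin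
  have hVenv : HasTypeIDecay A V := henv V hV hVlaw hVsing
  obtain ⟨Q, -, hS⟩ := Envelope.scaleInvariantBounds_of_minimal hmin hV hVlaw hVsing
  obtain ⟨L₁, hL₁⟩ := hS 1
  obtain ⟨K₂, hK₂0, hK₂⟩ := exists_norm_iteratedFDeriv_slice_le (1 : ℝ) 2
  set κ : ℝ := ‖curlCLM‖ with hκdef
  have hκ0 : 0 ≤ κ := by rw [hκdef]; exact norm_nonneg curlCLM
  set U : EuclideanSpace ℝ (Fin 3) → EuclideanSpace ℝ (Fin 3) := V (-1) with hUdef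
  set Ω : EuclideanSpace ℝ (Fin 3) → EuclideanSpace ℝ (Fin 3) := curl U with hΩdef
  have hUs : ContDiff ℝ ∞ U := hV.contDiff_slice (by norm_num)
  have hU2 : ContDiff ℝ 2 U := hUs.of_le (by norm_cast)
  have hΩ1 : ContDiff ℝ 1 Ω := contDiff_curl (hUs.of_le (by norm_cast))
  have hUenv : ∀ y, ‖U y‖ ≤ A / (‖y‖ + 1) := fun y => by
    have := hVenv (-1) (by norm_num) y
    rwa [neg_neg, Real.sqrt_one] at this
  have hL₁0 : 0 ≤ L₁ := by
    have h := (hL₁ (-1) (by norm_num) 0).1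
    rw [norm_zero, zero_add, neg_neg, Real.sqrt_one, one_pow, div_one] at h
    exact (norm_nonneg _).trans h
  have hΩb : ∀ y, ‖Ω y‖ ≤ κ * L₁ / (‖y‖ + 1) ^ 2 := fun y => by
    have h := (hL₁ (-1) (by norm_num) y).1
    rw [neg_neg, Real.sqrt_one, norm_iteratedFDeriv_one] at h
    calc ‖Ω y‖ ≤ κ * ‖fderiv ℝ U y‖ := norm_curl_le _ _
      _ ≤ κ * (L₁ / (‖y‖ + 1) ^ (1 + 1)) := mul_le_mul_of_nonneg_left h hκ0
      _ = κ * L₁ / (‖y‖ + 1) ^ 2 := by ring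
  have hDΩb : ∀ y, ‖fderiv ℝ Ω y‖ ≤ κ * K₂ := fun y =>
    (norm_fderiv_curl_le hU2 y).trans (mul_le_mul_of_nonneg_left (hK₂ hV y) hκ0)
  -- ### dichotomy
  by_cases hB : ∀ y, fderiv ℝ Ω y (Ω y) = 0
  · -- Case B: `DΩ Ω ≡ 0` ⇒ `Ω ≡ 0` ⇒ `U` constant ⇒ `U ≡ 0` ⇒ not singular
    have hdecay : ∀ ε : ℝ, 0 < ε → ∃ R : ℝ, ∀ y, R ≤ ‖y‖ → ‖Ω y‖ < ε := by
      intro ε hε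
      refine ⟨κ * L₁ / ε, fun y hy => ?_⟩
      have hy1 : 0 < ‖y‖ + 1 := by positivity
      have h1 : κ * L₁ / (‖y‖ + 1) ^ 2 ≤ κ * L₁ / (‖y‖ + 1) := by
        refine div_le_div_of_nonneg_left (mul_nonneg hκ0 hL₁0) hy1 ?_
        nlinarith [norm_nonneg y]
      have h2 : κ * L₁ / (‖y‖ + 1) < ε := by
        rw [div_lt_iff₀ hy1]
        have : κ * L₁ / ε * ε = κ * L₁ := div_mul_cancel₀ _ hε.ne'
        nlinarith [norm_nonneg y]
      exact (hΩb y).trans_lt (h1.trans_lt h2)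
    have hΩ0 : ∀ y, Ω y = 0 := eq_zero_of_fderiv_apply_self_eq_zero hΩ1 hDΩb hB hdecay
    have hdivU : VectorCalculus.IsDivFree U := hV.isDivFree (by norm_num)
    have hUb : ∀ y, ‖U y‖ ≤ A := fun y =>
      (hUenv y).trans (div_le_self hA0 (by linarith [norm_nonneg y]))
    have hconst : ∀ y, U y = U 0 := fun y =>
      eq_of_curl_eq_zero_of_isDivFree_of_bounded hU2 hΩ0 hdivU hUb y 0
    have hU0 : ∀ y, U y = 0 := by
      -- the constant value is killed by the envelope at infinity
      set c : EuclideanSpace ℝ (Fin 3) := U 0 with hc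
      by_contra hne
      push Not at hne
      obtain ⟨y₁, hy₁⟩ := hne
      have hc0 : c ≠ 0 := by rwa [hconst y₁] at hy₁
      have hcpos : 0 < ‖c‖ := norm_pos_iff.2 hc0
      -- the point `y = (A/‖c‖ + 1)/‖c‖ • c` has norm `A/‖c‖ + 1`
      set τ : ℝ := (A / ‖c‖ + 1) / ‖c‖ with hτ
      have hτ0 : 0 ≤ τ := by positivity
      have hny : ‖τ • c‖ = A / ‖c‖ + 1 := by
        rw [norm_smul, Real.norm_of_nonneg hτ0, hτ, div_mul_cancel₀ _ hcpos.ne']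
      have h1 := hUenv (τ • c)
      rw [hconst (τ • c), hny] at h1
      -- `‖c‖ ≤ A / (A/‖c‖ + 2)` is impossible
      have h2 : A / (A / ‖c‖ + 1 + 1) < ‖c‖ := by
        rw [div_lt_iff₀ (by positivity)]
        have : ‖c‖ * (A / ‖c‖) = A := mul_div_cancel₀ _ hcpos.ne'
        nlinarith
      linarith
    exact CalmSlice.not_singular_of_zero_slice hV (by norm_num) hU0 hVsing
  · -- Case A: `DΩ Ω ≠ 0` somewhere ⇒ `‖U‖ = 1` on an open set ⇒ everywhere ⇒ contradiction
    push Not at hB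
    obtain ⟨y₀, hy₀⟩ := hB
    have hcont : Continuous fun y => fderiv ℝ Ω y (Ω y) :=
      (hΩ1.continuous_fderiv one_ne_zero).clm_apply hΩ1.continuous
    have hO : IsOpen {y | fderiv ℝ Ω y (Ω y) ≠ 0} := isOpen_ne_fun hcont continuous_const
    have hone : ∀ y, fderiv ℝ Ω y (Ω y) ≠ 0 → ‖U y‖ = 1 := by
      intro y hy
      have h := hslack y
      rcases mul_eq_zero.1 h with h1 | h2
      · linarith
      · exact absurd (norm_eq_zero.1 h2) hy
    -- `‖U‖² − 1` is real-analytic and vanishes near `y₀`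
    have hUan : AnalyticOnNhd ℝ U univ := hV.analyticOnNhd_slice_univ (by norm_num)
    have hF : AnalyticOnNhd ℝ (fun y => ⟪U y, U y⟫ - 1) univ := by
      intro y _
      have hb := ((innerSL ℝ : EuclideanSpace ℝ (Fin 3) →L[ℝ] EuclideanSpace ℝ (Fin 3) →L[ℝ] ℝ)
        ).analyticAt_bilinear (U y, U y)
      have h2 := hb.comp₂ (hUan y (mem_univ _)) (hUan y (mem_univ _))
      exact h2.sub analyticAt_const
    have hev : (fun y => ⟪U y, U y⟫ - 1) =ᶠ[𝓝 y₀] 0 := by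
      filter_upwards [hO.mem_nhds hy₀] with y hy
      rw [Pi.zero_apply, real_inner_self_eq_norm_sq, hone y hy, one_pow, sub_self]
    have hall : ∀ y, ‖U y‖ = 1 := by
      intro y
      have h := hF.eqOn_zero_of_preconnected_of_eventuallyEq_zero (convex_univ).isPreconnected
        (mem_univ y₀) hev (mem_univ y)
      simp only [Pi.zero_apply, real_inner_self_eq_norm_sq, sub_eq_zero] at h
      nlinarith [norm_nonneg (U y)]
    -- contradiction with the envelope far out
    set x : EuclideanSpace ℝ (Fin 3) := (A + 1) • U 0 with hx
    have hnx : ‖x‖ = A + 1 := by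
      rw [hx, norm_smul, hall 0, mul_one, Real.norm_of_nonneg (by linarith)]
    have h1 := hUenv x
    rw [hall x, hnx] at h1
    have h2 : A / (A + 1 + 1) < 1 := by
      rw [div_lt_one (by linarith)]; linarith
    linarith

/-- **No finite-dissipation Type-I singularity has Type-I constant `C ≤ 1`** (a member with constant
`C ≤ 1` is a member with constant `1`). -/
theorem not_singular_of_typeI_le_one {C K : ℝ} (hC : C ≤ 1)
    {u : ℝ → EuclideanSpace ℝ (Fin 3) → EuclideanSpace ℝ (Fin 3)} (hu : IsTypeIAncientMild C u)
    (hlaw : ∀ s : ℝ, s < 0 → ∫⁻ x, ‖fderiv ℝ (u s) x‖ₑ ^ 2 ≤ ENNReal.ofReal (K / Real.sqrt (-s))) :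
    ¬ (∀ r > 0, ∀ M : ℝ, ∃ t ∈ Ioo (-(r ^ 2)) (0 : ℝ),
      ∃ x ∈ ball (0 : EuclideanSpace ℝ (Fin 3)) r, M < ‖u t x‖) := by
  have hu1 : IsTypeIAncientMild 1 u := by
    obtain ⟨h1, h2, h3, h4⟩ := hu
    refine ⟨h1, h2, h3, fun t ht x => (h4 t ht x).trans ?_⟩
    exact div_le_div_of_nonneg_right hC (Real.sqrt_nonneg _)
  exact not_singular_of_typeI_one hu1 hlaw

/-! ### The gap above the threshold -/

/-- **THE TYPE-I CONSTANT OF A FINITE-DISSIPATION TYPE-I SINGULARITY EXCEEDS `1` BY A DEFINITE,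
`K`-DEPENDENT AMOUNT.** For every `K` there is `ε > 0` such that no member of `𝒟_{C,K}` with
`C ≤ 1 + ε` is singular at the apex (compactness across members with `C_n ↓ 1`, persistence of the
singularity, the law of the limit, improvement of the limit's constant to `1`,
`not_singular_of_typeI_one`). [cite: KochNadirashviliSereginSverak2009, §4 (arXiv:0709.3599 p. 8)] -/
theorem exists_typeI_gap (K : ℝ) : ∃ ε : ℝ, 0 < ε ∧ ∀ C : ℝ, C ≤ 1 + ε →
    ∀ u : ℝ → EuclideanSpace ℝ (Fin 3) → EuclideanSpace ℝ (Fin 3), IsTypeIAncientMild C u →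
      (∀ s : ℝ, s < 0 → ∫⁻ x, ‖fderiv ℝ (u s) x‖ₑ ^ 2 ≤ ENNReal.ofReal (K / Real.sqrt (-s))) →
      ¬ (∀ r > 0, ∀ M : ℝ, ∃ t ∈ Ioo (-(r ^ 2)) (0 : ℝ),
        ∃ x ∈ ball (0 : EuclideanSpace ℝ (Fin 3)) r, M < ‖u t x‖) := by
  by_contra hcon
  push Not at hcon
  -- singular members with constants `C_n ≤ 1 + 1/(n+1)`
  have hk : ∀ n : ℕ, ∃ u : ℝ → EuclideanSpace ℝ (Fin 3) → EuclideanSpace ℝ (Fin 3),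
      IsTypeIAncientMild 2 u ∧
      (∀ t < 0, ∀ x, ‖u t x‖ ≤ (1 + 1 / ((n : ℝ) + 1)) / Real.sqrt (-t)) ∧
      (∀ s : ℝ, s < 0 → ∫⁻ x, ‖fderiv ℝ (u s) x‖ₑ ^ 2 ≤ ENNReal.ofReal (K / Real.sqrt (-s))) ∧
      (∀ r > 0, ∀ M : ℝ, ∃ t ∈ Ioo (-(r ^ 2)) (0 : ℝ),
        ∃ x ∈ ball (0 : EuclideanSpace ℝ (Fin 3)) r, M < ‖u t x‖) := by
    intro n
    obtain ⟨C, hC, u, hu, hlaw, hsing⟩ := hcon (1 / ((n : ℝ) + 1)) (by positivity)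
    obtain ⟨h1, h2, h3, h4⟩ := hu
    have hn : 1 / ((n : ℝ) + 1) ≤ 1 := by
      rw [div_le_one (by positivity)]
      have : (0 : ℝ) ≤ n := n.cast_nonneg
      linarith
    refine ⟨u, ⟨h1, h2, h3, fun t ht x => (h4 t ht x).trans ?_⟩, fun t ht x => (h4 t ht x).trans ?_,
      hlaw, hsing⟩
    · exact div_le_div_of_nonneg_right (by linarith) (Real.sqrt_nonneg _)
    · exact div_le_div_of_nonneg_right hC (Real.sqrt_nonneg _)
  choose u hu hub hlaw hsing using hk
  -- compactness across members (class constant `2`), law and singularity of the limit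
  obtain ⟨ψ, hψ, V, hV, hunif, hpt, hgrad⟩ := Compactness.seqLimit hu
  have hψt : Tendsto ψ atTop atTop := hψ.tendsto_atTop
  have hVlaw : ∀ s : ℝ, s < 0 →
      ∫⁻ x, ‖fderiv ℝ (V s) x‖ₑ ^ 2 ≤ ENNReal.ofReal (K / Real.sqrt (-s)) :=
    Compactness.law_of_seqLimit (Kk := fun _ => K) (Kinf := K) hψt hlaw
      (fun ε hε => Eventually.of_forall fun k => by linarith) hgrad
  have hVsing := Compactness.persistent_singularity_seq (w := fun j => u (ψ j))
    (fun j => hu _) (fun j => hlaw _) (fun j => hsing _) hV hunif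
  -- the limit's Type-I constant is `1`
  have hV1 : IsTypeIAncientMild 1 V := by
    obtain ⟨h1, h2, h3, -⟩ := hV
    refine ⟨h1, h2, h3, fun t ht x => ?_⟩
    have hlim : Tendsto (fun j => ‖u (ψ j) t x‖) atTop (𝓝 ‖V t x‖) := (hpt t ht x).norm
    have hbd : Tendsto (fun j => (1 + 1 / (((ψ j : ℕ) : ℝ) + 1)) / Real.sqrt (-t)) atTop
        (𝓝 ((1 + 0) / Real.sqrt (-t))) :=
      ((tendsto_one_div_add_atTop_nhds_zero_nat.comp hψt).const_add 1).div_const _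
    rw [add_zero] at hbd
    exact le_of_tendsto_of_tendsto' hlim hbd fun j => hub (ψ j) t ht x
  exact not_singular_of_typeI_one hV1 hVlaw hVsing

/-- **THE CRUX HOLDS BELOW THE GAP**: for every `K` there is `ε > 0` such that the signature of
`Theses.LerayQuarterDissipation.FiniteDissipationLiouville`, restricted to Type-I constants
`C ≤ 1 + ε`, holds. The unrestricted crux stays open (blocked on `∀ c > 1, TypeIDSSLiouville c`). -/
theorem finiteDissipationLiouville_below_gap (K : ℝ) : ∃ ε : ℝ, 0 < ε ∧ ∀ C : ℝ, C ≤ 1 + ε →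
    ∀ (ū : ℝ → EuclideanSpace ℝ (Fin 3) → EuclideanSpace ℝ (Fin 3)),
      Literature.Analysis.FluidPDE.IsTypeIAncientMild C ū →
      (∀ s : ℝ, s < 0 → ∫⁻ x, ‖fderiv ℝ (ū s) x‖ₑ ^ 2 ≤ ENNReal.ofReal (K / Real.sqrt (-s))) →
      ¬ (∀ r > 0, ∀ M : ℝ, ∃ t ∈ Set.Ioo (-(r ^ 2)) (0 : ℝ),
        ∃ x ∈ Metric.ball (0 : EuclideanSpace ℝ (Fin 3)) r, M < ‖ū t x‖) :=
  exists_typeI_gap K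

/-- **Bookkeeping: the crux is its own restriction to Type-I constants above the gap.** -/
theorem finiteDissipationLiouville_iff_above_gap :
    Theses.LerayQuarterDissipation.FiniteDissipationLiouville ↔
    ∀ (C K : ℝ), (∀ ε : ℝ, 0 < ε → (∀ C' : ℝ, C' ≤ 1 + ε →
        ∀ u : ℝ → EuclideanSpace ℝ (Fin 3) → EuclideanSpace ℝ (Fin 3), IsTypeIAncientMild C' u →
        (∀ s : ℝ, s < 0 → ∫⁻ x, ‖fderiv ℝ (u s) x‖ₑ ^ 2 ≤ ENNReal.ofReal (K / Real.sqrt (-s))) →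
        ¬ (∀ r > 0, ∀ M : ℝ, ∃ t ∈ Ioo (-(r ^ 2)) (0 : ℝ),
          ∃ x ∈ ball (0 : EuclideanSpace ℝ (Fin 3)) r, M < ‖u t x‖)) → 1 + ε < C) →
      ∀ (ū : ℝ → EuclideanSpace ℝ (Fin 3) → EuclideanSpace ℝ (Fin 3)),
        IsTypeIAncientMild C ū →
        (∀ s : ℝ, s < 0 → ∫⁻ x, ‖fderiv ℝ (ū s) x‖ₑ ^ 2 ≤ ENNReal.ofReal (K / Real.sqrt (-s))) →
        ¬ (∀ r > 0, ∀ M : ℝ, ∃ t ∈ Set.Ioo (-(r ^ 2)) (0 : ℝ),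
          ∃ x ∈ Metric.ball (0 : EuclideanSpace ℝ (Fin 3)) r, M < ‖ū t x‖) := by
  constructor
  · intro hL C K _ ū hū hlaw
    exact hL C K ū hū hlaw
  · intro h C K ū hū hlaw hsing
    obtain ⟨ε, hε, hgap⟩ := exists_typeI_gap K
    by_cases hCε : C ≤ 1 + ε
    · exact hgap C hCε ū hū hlaw hsing
    · exact h C K (fun ε' hε' hgap' => by
        by_contra hle
        push Not at hle
        exact hgap' C hle ū hū hlaw hsing) ū hū hlaw hsing

end Summit.NavierStokesRegularity.NavierStokesRegularity.Theorems.FiniteDissipationLiouville.ThresholdOne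

end
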